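import Literature.MathematicalPhysics.QuantumFieldTheory.Balaban1983to89.B14Eq328GaussianIBP
import Literature.MathematicalPhysics.QuantumFieldTheory.Balaban1983to89.B14InterpolationMeasure

/-!
# `Balaban1983to89.B14.Eq329Family` — T. Bałaban, *Convergent renormalization expansions for lattice gauge theories*,
# Commun. Math. Phys. **119** (1988) 243–285 [Balaban1988Convergent] = [III]: (3.29) p. 272 — THE PROBABILISTIC MEASURE
# `⟨·⟩_t` OF (3.28) FOR GENUINE FINITE-DIMENSIONAL GAUSSIAN INTEGRALS IS A DOMINATED DIFFERENTIABLE FAMILY; THE FIRST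
# EQUALITY OF (3.28) IN GIBBS FORM (file 1 of 2; file 2 = `B14.Eq328Printed`, the two printed equalities of (3.28))

statement-level skeleton of published theorems with citation tags; proofs where landed; nothing here is a claim
about the Yang–Mills mass gap

CITATION HEADER (lean-in-tree rule).  T. Bałaban, *Convergent renormalization expansions for lattice gauge theories*,
Commun. Math. Phys. **119**, 243–285 (1988), doi:10.1007/BF01217741, bib `Balaban1988Convergent` (cell paper B14 = "[III]";
PDF held `paper:balaban1988-cmp119-convergent-renormalization`, journal page = PDF page + 242; (3.28)–(3.29) RE-READ for this
file on the x2 renders `…-p029-x2.png` / `…-p030-x2.png` of `run/shared/lean/pub/pub-balaban/b2b-balaban-ref1/pages/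
1988-cmp119-convergent-renormalization/`).  Mega-formalization `lit-balaban` (HOME `run/shared/lean/pub/lit-balaban/`), Phase-2
proof seat **p27 gen 91** (free target, protocol G.5-34 (d), TAKING line HOME/STATUS 2026-08-26T01:13Z; B14 fold owner r11);
SKELETON row **B14.Eq3.28–3.29** (cells only; decls of record `B14.Interpolation.Eq330` and r11's `B14.Eq328GaussianIBP.*`
untouched).

THE PRINT (p. 272 [PDF 30], verbatim from the render).  *"Here ⟨·⟩_t denotes the expectation value with respect to the
probabilistic measure
  Z_t^{−1} dμ_{C^{(k)}(Λ_{k+1})}(A) χ^{(k)} exp[−t⟨A, C*Δ^{(k)}CA_k⟩ + 𝐏^{(k)}(g_k, (tA_k, A)) + {𝐄_k(U_k(…(tA_k, A)…)) − 𝐄_k(U_{k+1})}].  (3.29)"*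
and, p. 271, *"We introduce the parameter t multiplying A_k in the expressions in the logarithm. We have
log[…] = ∫₀¹ dt ⟨−⟨A, C*Δ^{(k)}CA_k⟩ + ⟨(δ/δtA_k)𝐏^{(k)}(g_k,(tA_k,A)), A_k⟩ + ⟨(δ/δtA_k)𝐄_k(U_k(….)), A_k⟩⟩_t − … + log[…(A_k = 0)…]"*
(the first equality of (3.28)).

READING (as recorded in r11's `B14.Eq328GaussianIBP`; the objects of §2 of the paper are not constructed in the tree).  The
fluctuation variable `A` ranges over the finite-dimensional real space `ι → ℝ` of `Λ_{k+1}`-fields; `dμ_C`, `C := C^{(k)}(Λ_{k+1})`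
positive definite, is the Gaussian measure with density `e^{−½vᵀC⁻¹v}` (normalization dropped — it is common to all members of
(3.28)); the external field `A_k = a ∈ κ → ℝ`; `w₀ := C*Δ^{(k)}CA_k`, so `⟨A, C*Δ^{(k)}CA_k⟩ = ⟨v, w₀⟩`; the cut-off `χ := χ^{(k)}`;
`𝐏(a′,v) := 𝐏^{(k)}(g_k,(a′,A))`, `𝐄(a′,v) := 𝐄_k(U_k(…(a′,A)…))`, `𝐄₁ := 𝐄_k(U_{k+1})`; *"the parameter t multiplying A_k"* is
`a′ = t•a`, and `⟨(δ/δtA_k)𝐏(g_k,(tA_k,A)), A_k⟩ = d/dt 𝐏(t•a,v) = fderiv(a′ ↦ 𝐏(a′,v))(t•a) a` (chain rule).  In the vocabulary of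
p27's `B14.InterpolationMeasure` (gen 2): reference weight `w = χ·e^{−½vᵀC⁻¹v}`, exponent `S_t(v) = −t⟨v,w₀⟩ + 𝐏(t•a,v) +
{𝐄(t•a,v) − 𝐄₁}`, `Z_t = partFn volume w S t`, `⟨G⟩_t = gibbsExpect volume w S G t`, the (3.29) law = `gibbsLaw volume w S t`.

WHAT THIS FILE PROVES (kernel-checked, zero `sorry`; THEOREMS ONLY — no `def`, no new `Prop`, no named fact; axioms standard),
for `χ ∈ C¹(ι → ℝ)`, `χ ≥ 0`, compactly supported, `≢ 0`, and `𝐏, 𝐄 ∈ C¹` jointly on `(κ → ℝ) × (ι → ℝ)`: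
* §1 calculus: `fderiv_div_mul_self` — `(∂_uχ/χ)·χ = ∂_uχ` EVERYWHERE (`χ ≥ 0`: where `χ = 0` the derivative vanishes), the
  honest reading of print's formal *"(δ/δA)χ^{(k)}"* inside `⟨·⟩_t` for a smooth cut-off; partial derivatives / the chain rule
  along `t ↦ t•a` from the joint derivative; the `C¹` weight `H_t = χ·exp[𝐏(t•a,·) + {𝐄(t•a,·) − 𝐄₁}]` and `∂_uH_t`;
* §2 the family: continuity, compact support, **`partFn_pos`** (`Z_t > 0` for every `t`), the `t`-derivative
  `hasDerivAt_gibbsWeight`, **`domFamily`** — the (3.29) family is a `B14.InterpolationMeasure.DomFamily` on `(−1,2) ⊃ [0,1]`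
  (domination by a constant times the indicator of `tsupport χ`), hence **`eq328_ftc`**: `log Z_1 = log Z_0 + ∫₀¹ dt ⟨∂_tS_t⟩_t`,
  `∂_tS_t(v) = −⟨v,w₀⟩ + fderiv(a′ ↦ 𝐏(a′,v))(t•a) a + fderiv(a′ ↦ 𝐄(a′,v))(t•a) a` — the typed shape `B14.Interpolation.Eq330`
  INHABITED by THIS family (the first equality of (3.28) before the constant `−½⟨w₀,Cw₀⟩` is split off), and its interval
  integrability.
HONEST SCOPE.  Print's `χ^{(k)}` is a sharp characteristic function; here `χ` is a `C¹` cut-off (r11's scope note (i) of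
`B14.Eq328GaussianIBP`); `𝐏`, `𝐄` are assumed `C¹` on the whole product space (print: analytic on a neighbourhood of the domain
cut out by `χ^{(k)}`); the identification with Bałaban's operators is the READING above.  NOT summit progress.  p27 gen 91
(literature-prover-lit-balaban-p27-g91-0), 2026-08-26.
-/

noncomputable section

open MeasureTheory Matrix Real Filter Topology Set
open scoped Matrix BigOperators

namespace Literature.MathematicalPhysics.QuantumFieldTheory.Balaban1983to89.B14.Eq329Family

open B14.InterpolationMeasure B14.Eq328GaussianIBP

variable {ι κ : Type*} [Fintype ι] [Fintype κ]


/-! ## §1  Pointwise calculus: the logarithmic derivative of the cut-off, partial derivatives, the chain rule in `tA_k`,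
the `C¹` weight `H_t = χ·exp[𝐏(t•a,·) + {𝐄(t•a,·) − 𝐄₁}]` -/

/-- **The logarithmic-derivative convention is harmless**: for a `C¹`-or-not cut-off `χ ≥ 0`, `(∂_uχ(v)/χ(v))·χ(v) = ∂_uχ(v)`
at EVERY point — where `χ(v) = 0` the point is a minimum of `χ`, so `fderiv χ v = 0` (Fermat), and Lean's `x/0 = 0` matches.
This is why print's *"(δ/δA)χ^{(k)}"* inside the expectation `⟨·⟩_t` of (3.28) can be read as `∇χ/χ` for a smooth cut-off.
[cite: Balaban1988Convergent, (3.28) p.272] -/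
theorem fderiv_div_mul_self {χ : (ι → ℝ) → ℝ} (hχ0 : ∀ v, 0 ≤ χ v) (v u : ι → ℝ) :
    fderiv ℝ χ v u / χ v * χ v = fderiv ℝ χ v u := by
  by_cases h : χ v = 0
  · have hmin : IsLocalMin χ v := Filter.Eventually.of_forall fun x => by rw [h]; exact hχ0 x
    rw [hmin.fderiv_eq_zero, h]; simp
  · rw [div_mul_cancel₀ _ h]

/-- The partial derivative in the external field (`δ/δ(tA_k)` of (3.28)) from the joint derivative: for `𝐏 ∈ C¹` jointly,
`a′ ↦ 𝐏(a′, v)` has derivative `D𝐏(a′,v)∘inl`. [cite: Balaban1988Convergent, (3.28) p.271] -/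
theorem hasFDerivAt_partial_fst {P : (κ → ℝ) → (ι → ℝ) → ℝ} (hP : ContDiff ℝ 1 (Function.uncurry P))
    (a' : κ → ℝ) (v : ι → ℝ) :
    HasFDerivAt (fun a'' => P a'' v)
      ((fderiv ℝ (Function.uncurry P) (a', v)).comp (ContinuousLinearMap.inl ℝ (κ → ℝ) (ι → ℝ))) a' := by
  have hd : HasFDerivAt (Function.uncurry P) (fderiv ℝ (Function.uncurry P) (a', v)) (a', v) :=
    ((hP.differentiable one_ne_zero) (a', v)).hasFDerivAt
  have hi : HasFDerivAt (fun a'' : κ → ℝ => (a'', v)) (ContinuousLinearMap.inl ℝ (κ → ℝ) (ι → ℝ)) a' :=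
    (hasFDerivAt_id a').prodMk (hasFDerivAt_const v a')
  exact hd.comp a' hi

/-- The partial derivative in the fluctuation field (`δ/δA` of (3.28)) from the joint derivative: `v ↦ 𝐏(a′, v)` has derivative
`D𝐏(a′,v)∘inr`. [cite: Balaban1988Convergent, (3.28) p.272] -/
theorem hasFDerivAt_partial_snd {P : (κ → ℝ) → (ι → ℝ) → ℝ} (hP : ContDiff ℝ 1 (Function.uncurry P))
    (a' : κ → ℝ) (v : ι → ℝ) :
    HasFDerivAt (fun v' => P a' v')
      ((fderiv ℝ (Function.uncurry P) (a', v)).comp (ContinuousLinearMap.inr ℝ (κ → ℝ) (ι → ℝ))) v := by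
  have hd : HasFDerivAt (Function.uncurry P) (fderiv ℝ (Function.uncurry P) (a', v)) (a', v) :=
    ((hP.differentiable one_ne_zero) (a', v)).hasFDerivAt
  have hi : HasFDerivAt (fun v' : ι → ℝ => (a', v')) (ContinuousLinearMap.inr ℝ (κ → ℝ) (ι → ℝ)) v :=
    (hasFDerivAt_const a' v).prodMk (hasFDerivAt_id v)
  exact hd.comp v hi

/-- `⟨(δ/δa′)𝐏(a′,v), u⟩ = D𝐏(a′,v)(u, 0)`. [cite: Balaban1988Convergent, (3.28) p.271] -/
theorem fderiv_partial_fst_apply {P : (κ → ℝ) → (ι → ℝ) → ℝ} (hP : ContDiff ℝ 1 (Function.uncurry P))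
    (a' : κ → ℝ) (v : ι → ℝ) (u : κ → ℝ) :
    fderiv ℝ (fun a'' => P a'' v) a' u = fderiv ℝ (Function.uncurry P) (a', v) (u, 0) := by
  rw [(hasFDerivAt_partial_fst hP a' v).fderiv]
  simp

/-- `⟨(δ/δA)𝐏(a′,v), u⟩ = D𝐏(a′,v)(0, u)`. [cite: Balaban1988Convergent, (3.28) p.272] -/
theorem fderiv_partial_snd_apply {P : (κ → ℝ) → (ι → ℝ) → ℝ} (hP : ContDiff ℝ 1 (Function.uncurry P))
    (a' : κ → ℝ) (v u : ι → ℝ) :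
    fderiv ℝ (fun v' => P a' v') v u = fderiv ℝ (Function.uncurry P) (a', v) (0, u) := by
  rw [(hasFDerivAt_partial_snd hP a' v).fderiv]
  simp

/-- **The chain rule in *"the parameter t multiplying A_k"***: `d/dt 𝐏(t•a, v) = ⟨(δ/δ(tA_k))𝐏(tA_k, v), A_k⟩`, i.e.
`fderiv (a′ ↦ 𝐏(a′,v)) (t•a) a`. [cite: Balaban1988Convergent, (3.28) p.271] -/
theorem hasDerivAt_line {P : (κ → ℝ) → (ι → ℝ) → ℝ} (hP : ContDiff ℝ 1 (Function.uncurry P))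
    (a : κ → ℝ) (v : ι → ℝ) (t : ℝ) :
    HasDerivAt (fun s : ℝ => P (s • a) v) (fderiv ℝ (fun a'' => P a'' v) (t • a) a) t := by
  have h1 : HasDerivAt (fun s : ℝ => s • a) a t := by
    simpa using (hasDerivAt_id t).smul_const a
  have h3 := (hasFDerivAt_partial_fst hP (t • a) v).comp_hasDerivAt t h1
  rw [(hasFDerivAt_partial_fst hP (t • a) v).fderiv]
  exact h3

/-- Joint continuity of `(t, v) ↦ ⟨(δ/δ(tA_k))𝐏(tA_k, v), u⟩`. [cite: Balaban1988Convergent, (3.28) p.271] -/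
theorem continuous_fderiv_fst {P : (κ → ℝ) → (ι → ℝ) → ℝ} (hP : ContDiff ℝ 1 (Function.uncurry P))
    (a u : κ → ℝ) :
    Continuous fun p : ℝ × (ι → ℝ) => fderiv ℝ (fun a'' => P a'' p.2) (p.1 • a) u := by
  have hc : Continuous (fderiv ℝ (Function.uncurry P)) := hP.continuous_fderiv one_ne_zero
  have h1 : Continuous fun p : ℝ × (ι → ℝ) => fderiv ℝ (Function.uncurry P) (p.1 • a, p.2) (u, 0) :=
    ((hc.comp ((continuous_fst.smul continuous_const).prodMk continuous_snd)).clm_apply continuous_const)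
  refine h1.congr fun p => ?_
  rw [fderiv_partial_fst_apply hP]

/-- Joint continuity of `(t, v) ↦ ⟨(δ/δA)𝐏(tA_k, v), u⟩`. [cite: Balaban1988Convergent, (3.28) p.272] -/
theorem continuous_fderiv_snd {P : (κ → ℝ) → (ι → ℝ) → ℝ} (hP : ContDiff ℝ 1 (Function.uncurry P))
    (a : κ → ℝ) (u : ι → ℝ) :
    Continuous fun p : ℝ × (ι → ℝ) => fderiv ℝ (fun v' => P (p.1 • a) v') p.2 u := by
  have hc : Continuous (fderiv ℝ (Function.uncurry P)) := hP.continuous_fderiv one_ne_zero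
  have h1 : Continuous fun p : ℝ × (ι → ℝ) => fderiv ℝ (Function.uncurry P) (p.1 • a, p.2) (0, u) :=
    ((hc.comp ((continuous_fst.smul continuous_const).prodMk continuous_snd)).clm_apply continuous_const)
  refine h1.congr fun p => ?_
  rw [fderiv_partial_snd_apply hP]

/-- Joint continuity of `(t, v) ↦ 𝐏(t•a, v)`. [cite: Balaban1988Convergent, (3.29) p.272] -/
theorem continuous_eval {P : (κ → ℝ) → (ι → ℝ) → ℝ} (hP : ContDiff ℝ 1 (Function.uncurry P)) (a : κ → ℝ) :
    Continuous fun p : ℝ × (ι → ℝ) => P (p.1 • a) p.2 :=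
  hP.continuous.comp ((continuous_fst.smul continuous_const).prodMk continuous_snd)

/-- The weight `H = χ·exp[𝐏(a′,·) + {𝐄(a′,·) − 𝐄₁}]` of (3.29) (without the linear tilt) is `C¹` — the `H ∈ C¹` of r11's
`eq328_tilted_ibp` / `eq328_linear_term`. [cite: Balaban1988Convergent, (3.29) p.272] -/
theorem weight_contDiff {χ : (ι → ℝ) → ℝ} (hχ : ContDiff ℝ 1 χ) {P E : (κ → ℝ) → (ι → ℝ) → ℝ}
    (hP : ContDiff ℝ 1 (Function.uncurry P)) (hE : ContDiff ℝ 1 (Function.uncurry E)) (a' : κ → ℝ) (E₁ : ℝ) :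
    ContDiff ℝ 1 fun v => χ v * Real.exp (P a' v + (E a' v - E₁)) := by
  have hP1 : ContDiff ℝ 1 fun v' => P a' v' := hP.comp (contDiff_const.prodMk contDiff_id)
  have hE1 : ContDiff ℝ 1 fun v' => E a' v' := hE.comp (contDiff_const.prodMk contDiff_id)
  exact hχ.mul (hP1.add (hE1.sub contDiff_const)).exp

/-- **`∂_uH = (∂_uχ)·e^{𝐏+𝐄−𝐄₁} + χ·e^{𝐏+𝐄−𝐄₁}·(∂_u𝐏 + ∂_u𝐄)`** — print's `H·⟨u, (δ/δA)(χ + 𝐏 + 𝐄)⟩` with the `χ`-term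
written honestly (product and chain rule). [cite: Balaban1988Convergent, (3.28) p.272] -/
theorem fderiv_weight_apply {χ : (ι → ℝ) → ℝ} (hχ : ContDiff ℝ 1 χ) {P E : (κ → ℝ) → (ι → ℝ) → ℝ}
    (hP : ContDiff ℝ 1 (Function.uncurry P)) (hE : ContDiff ℝ 1 (Function.uncurry E)) (a' : κ → ℝ) (E₁ : ℝ)
    (v u : ι → ℝ) :
    fderiv ℝ (fun v => χ v * Real.exp (P a' v + (E a' v - E₁))) v u
      = fderiv ℝ χ v u * Real.exp (P a' v + (E a' v - E₁))
        + χ v * Real.exp (P a' v + (E a' v - E₁))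
          * (fderiv ℝ (fun v' => P a' v') v u + fderiv ℝ (fun v' => E a' v') v u) := by
  have hP1 : ContDiff ℝ 1 fun v' => P a' v' := hP.comp (contDiff_const.prodMk contDiff_id)
  have hE1 : ContDiff ℝ 1 fun v' => E a' v' := hE.comp (contDiff_const.prodMk contDiff_id)
  have dχ : HasFDerivAt χ (fderiv ℝ χ v) v := ((hχ.differentiable one_ne_zero) v).hasFDerivAt
  have dP : HasFDerivAt (fun v' => P a' v') (fderiv ℝ (fun v' => P a' v') v) v :=
    ((hP1.differentiable one_ne_zero) v).hasFDerivAt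
  have dE : HasFDerivAt (fun v' => E a' v') (fderiv ℝ (fun v' => E a' v') v) v :=
    ((hE1.differentiable one_ne_zero) v).hasFDerivAt
  have dS : HasFDerivAt (fun v' => P a' v' + (E a' v' - E₁))
      (fderiv ℝ (fun v' => P a' v') v + fderiv ℝ (fun v' => E a' v') v) v :=
    dP.add (dE.sub_const E₁)
  have dexp : HasFDerivAt (fun v' => Real.exp (P a' v' + (E a' v' - E₁)))
      (Real.exp (P a' v + (E a' v - E₁)) • (fderiv ℝ (fun v' => P a' v') v + fderiv ℝ (fun v' => E a' v') v)) v :=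
    (Real.hasDerivAt_exp _).comp_hasFDerivAt v dS
  have dH := dχ.fun_mul dexp
  rw [dH.fderiv]
  simp only [_root_.add_apply, _root_.smul_apply, smul_eq_mul]
  ring

/-! ## §2  The (3.29) family `Z_t = ∫ χ exp[−t⟨v,w₀⟩ + 𝐏(t•a,v) + {𝐄(t•a,v) − 𝐄₁}] e^{−½vᵀC⁻¹v} dv` as a dominated family -/

section Family

variable [DecidableEq ι]
variable (C : Matrix ι ι ℝ) (w₀ : ι → ℝ) (a : κ → ℝ) {χ : (ι → ℝ) → ℝ} {P E : (κ → ℝ) → (ι → ℝ) → ℝ} (E₁ : ℝ)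

omit [Fintype κ] in
/-- The (3.29) weight in the shape of r11's §4: `w(v)e^{S_t(v)} = e^{−t⟨v,w₀⟩}·H_t(v)·e^{−½vᵀC⁻¹v}` with
`H_t = χ·exp[𝐏(t•a,·) + {𝐄(t•a,·) − 𝐄₁}]`. [cite: Balaban1988Convergent, (3.29) p.272] -/
theorem gibbsWeight_eq {w : (ι → ℝ) → ℝ} {S : ℝ → (ι → ℝ) → ℝ}
    (hw : w = fun v => χ v * Real.exp (-(1/2 : ℝ) * (v ⬝ᵥ C⁻¹ *ᵥ v)))
    (hS : S = fun t v => -(t * (v ⬝ᵥ w₀)) + (P (t • a) v + (E (t • a) v - E₁))) (t : ℝ) (v : ι → ℝ) :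
    gibbsWeight w S t v = Real.exp (-(t * (v ⬝ᵥ w₀))) * (χ v * Real.exp (P (t • a) v + (E (t • a) v - E₁)))
      * Real.exp (-(1/2 : ℝ) * (v ⬝ᵥ C⁻¹ *ᵥ v)) := by
  simp only [gibbsWeight, hw, hS, Real.exp_add]
  ring

/-- Joint continuity of the (3.29) weight `(t, v) ↦ w(v)e^{S_t(v)}`. [cite: Balaban1988Convergent, (3.29) p.272] -/
theorem continuous_gibbsWeight₂ (hχ : ContDiff ℝ 1 χ) (hP : ContDiff ℝ 1 (Function.uncurry P))
    (hE : ContDiff ℝ 1 (Function.uncurry E)) {w : (ι → ℝ) → ℝ} {S : ℝ → (ι → ℝ) → ℝ}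
    (hw : w = fun v => χ v * Real.exp (-(1/2 : ℝ) * (v ⬝ᵥ C⁻¹ *ᵥ v)))
    (hS : S = fun t v => -(t * (v ⬝ᵥ w₀)) + (P (t • a) v + (E (t • a) v - E₁))) :
    Continuous fun p : ℝ × (ι → ℝ) => gibbsWeight w S p.1 p.2 := by
  have h1 : Continuous fun p : ℝ × (ι → ℝ) => χ p.2 := hχ.continuous.comp continuous_snd
  have h2 : Continuous fun p : ℝ × (ι → ℝ) => Real.exp (-(1/2 : ℝ) * (p.2 ⬝ᵥ C⁻¹ *ᵥ p.2)) :=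
    (continuous_const.mul (continuous_snd.dotProduct (continuous_const.matrix_mulVec continuous_snd))).rexp
  have h3 : Continuous fun p : ℝ × (ι → ℝ) => -(p.1 * (p.2 ⬝ᵥ w₀)) + (P (p.1 • a) p.2 + (E (p.1 • a) p.2 - E₁)) :=
    ((continuous_fst.mul (continuous_snd.dotProduct continuous_const)).neg).add
      ((continuous_eval hP a).add ((continuous_eval hE a).sub continuous_const))
  refine ((h1.mul h2).mul h3.rexp).congr fun p => ?_
  simp only [Pi.mul_apply, gibbsWeight, hw, hS]

/-- Continuity of the weight in the fluctuation variable for fixed `t`. [cite: Balaban1988Convergent, (3.29) p.272] -/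
theorem continuous_gibbsWeight (hχ : ContDiff ℝ 1 χ) (hP : ContDiff ℝ 1 (Function.uncurry P))
    (hE : ContDiff ℝ 1 (Function.uncurry E)) {w : (ι → ℝ) → ℝ} {S : ℝ → (ι → ℝ) → ℝ}
    (hw : w = fun v => χ v * Real.exp (-(1/2 : ℝ) * (v ⬝ᵥ C⁻¹ *ᵥ v)))
    (hS : S = fun t v => -(t * (v ⬝ᵥ w₀)) + (P (t • a) v + (E (t • a) v - E₁))) (t : ℝ) :
    Continuous fun v => gibbsWeight w S t v :=
  (continuous_gibbsWeight₂ C w₀ a E₁ hχ hP hE hw hS).comp (continuous_const.prodMk continuous_id)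

omit [Fintype κ] in
/-- The weight has compact support in `v` (inside `supp χ`). [cite: Balaban1988Convergent, (3.29) p.272] -/
theorem hasCompactSupport_gibbsWeight (hχs : HasCompactSupport χ) {w : (ι → ℝ) → ℝ} (S : ℝ → (ι → ℝ) → ℝ)
    (hw : w = fun v => χ v * Real.exp (-(1/2 : ℝ) * (v ⬝ᵥ C⁻¹ *ᵥ v))) (t : ℝ) :
    HasCompactSupport fun v => gibbsWeight w S t v := by
  have heq : (fun v => gibbsWeight w S t v)
      = fun v => χ v * (Real.exp (-(1/2 : ℝ) * (v ⬝ᵥ C⁻¹ *ᵥ v)) * Real.exp (S t v)) := by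
    funext v; simp only [gibbsWeight, hw]; ring
  rw [heq]
  exact hχs.mul_right

omit [Fintype κ] in
/-- The weight vanishes off `tsupport χ`. [cite: Balaban1988Convergent, (3.29) p.272] -/
theorem gibbsWeight_eq_zero_of_notMem {w : (ι → ℝ) → ℝ} (S : ℝ → (ι → ℝ) → ℝ)
    (hw : w = fun v => χ v * Real.exp (-(1/2 : ℝ) * (v ⬝ᵥ C⁻¹ *ᵥ v))) (t : ℝ) {v : ι → ℝ} (hv : v ∉ tsupport χ) :
    gibbsWeight w S t v = 0 := by
  simp only [gibbsWeight, hw, image_eq_zero_of_notMem_tsupport hv, zero_mul]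

omit [Fintype κ] in
/-- The weight is non-negative (`χ ≥ 0`). [cite: Balaban1988Convergent, (3.29) p.272] -/
theorem gibbsWeight_nonneg' (hχ0 : ∀ v, 0 ≤ χ v) {w : (ι → ℝ) → ℝ} (S : ℝ → (ι → ℝ) → ℝ)
    (hw : w = fun v => χ v * Real.exp (-(1/2 : ℝ) * (v ⬝ᵥ C⁻¹ *ᵥ v))) (t : ℝ) (v : ι → ℝ) :
    0 ≤ gibbsWeight w S t v := by
  simp only [gibbsWeight, hw]
  exact mul_nonneg (mul_nonneg (hχ0 v) (Real.exp_nonneg _)) (Real.exp_nonneg _)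

/-- A continuous insert against the weight is integrable (continuous, compactly supported).
[cite: Balaban1988Convergent, (3.29) p.272] -/
theorem integrable_insert_mul_gibbsWeight (hχ : ContDiff ℝ 1 χ) (hχs : HasCompactSupport χ)
    (hP : ContDiff ℝ 1 (Function.uncurry P)) (hE : ContDiff ℝ 1 (Function.uncurry E))
    {w : (ι → ℝ) → ℝ} {S : ℝ → (ι → ℝ) → ℝ}
    (hw : w = fun v => χ v * Real.exp (-(1/2 : ℝ) * (v ⬝ᵥ C⁻¹ *ᵥ v)))
    (hS : S = fun t v => -(t * (v ⬝ᵥ w₀)) + (P (t • a) v + (E (t • a) v - E₁))) (t : ℝ)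
    {G : (ι → ℝ) → ℝ} (hG : Continuous G) :
    Integrable (fun v => G v * gibbsWeight w S t v) :=
  (hG.mul (continuous_gibbsWeight C w₀ a E₁ hχ hP hE hw hS t)).integrable_of_hasCompactSupport
    (hasCompactSupport_gibbsWeight C hχs S hw t).mul_left

/-- **`Z_t > 0` for every `t`** (so `log Z_t` and `Z_t⁻¹` of (3.28)/(3.29) are meaningful): the weight is continuous, `≥ 0`,
and positive where `χ ≠ 0`. [cite: Balaban1988Convergent, (3.29) p.272] -/
theorem partFn_pos (hχ : ContDiff ℝ 1 χ) (hχs : HasCompactSupport χ) (hχ0 : ∀ v, 0 ≤ χ v)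
    (hχne : ∃ v, χ v ≠ 0) (hP : ContDiff ℝ 1 (Function.uncurry P)) (hE : ContDiff ℝ 1 (Function.uncurry E))
    {w : (ι → ℝ) → ℝ} {S : ℝ → (ι → ℝ) → ℝ}
    (hw : w = fun v => χ v * Real.exp (-(1/2 : ℝ) * (v ⬝ᵥ C⁻¹ *ᵥ v)))
    (hS : S = fun t v => -(t * (v ⬝ᵥ w₀)) + (P (t • a) v + (E (t • a) v - E₁))) (t : ℝ) :
    0 < partFn volume w S t := by
  obtain ⟨v₀, hv₀⟩ := hχne
  refine (continuous_gibbsWeight C w₀ a E₁ hχ hP hE hw hS t).integral_pos_of_hasCompactSupport_nonneg_nonzero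
    (hasCompactSupport_gibbsWeight C hχs S hw t) (fun v => gibbsWeight_nonneg' C hχ0 S hw t v) (x := v₀) ?_
  simp only [gibbsWeight, hw]
  exact mul_ne_zero (mul_ne_zero hv₀ (Real.exp_pos _).ne') (Real.exp_pos _).ne'

omit [DecidableEq ι] in
/-- Joint continuity of the derivative insert `∂_tS_t(v) = −⟨v,w₀⟩ + ⟨(δ/δtA_k)𝐏, A_k⟩ + ⟨(δ/δtA_k)𝐄, A_k⟩`.
[cite: Balaban1988Convergent, (3.28) p.271] -/
theorem continuous_S'₂ (hP : ContDiff ℝ 1 (Function.uncurry P)) (hE : ContDiff ℝ 1 (Function.uncurry E))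
    {S' : ℝ → (ι → ℝ) → ℝ}
    (hS' : S' = fun t v => -(v ⬝ᵥ w₀) + (fderiv ℝ (fun a' => P a' v) (t • a) a + fderiv ℝ (fun a' => E a' v) (t • a) a)) :
    Continuous fun p : ℝ × (ι → ℝ) => S' p.1 p.2 := by
  rw [hS']
  exact (continuous_snd.dotProduct continuous_const).neg.add
    ((continuous_fderiv_fst hP a a).add (continuous_fderiv_fst hE a a))

omit [DecidableEq ι] in
/-- **The `t`-derivative of the (3.29) weight**: `∂_t(w e^{S_t}) = (∂_tS_t)·w e^{S_t}` with
`∂_tS_t(v) = −⟨v,w₀⟩ + fderiv(a′ ↦ 𝐏(a′,v))(t•a) a + fderiv(a′ ↦ 𝐄(a′,v))(t•a) a` — the chain rule in *"the parameter t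
multiplying A_k"*. [cite: Balaban1988Convergent, (3.28)–(3.29) pp.271–272] -/
theorem hasDerivAt_gibbsWeight (hP : ContDiff ℝ 1 (Function.uncurry P)) (hE : ContDiff ℝ 1 (Function.uncurry E))
    (w : (ι → ℝ) → ℝ) {S S' : ℝ → (ι → ℝ) → ℝ}
    (hS : S = fun t v => -(t * (v ⬝ᵥ w₀)) + (P (t • a) v + (E (t • a) v - E₁)))
    (hS' : S' = fun t v => -(v ⬝ᵥ w₀) + (fderiv ℝ (fun a' => P a' v) (t • a) a + fderiv ℝ (fun a' => E a' v) (t • a) a))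
    (v : ι → ℝ) (t : ℝ) :
    HasDerivAt (fun s => gibbsWeight w S s v) (S' t v * gibbsWeight w S t v) t := by
  have hlin : HasDerivAt (fun s : ℝ => -(s * (v ⬝ᵥ w₀))) (-(v ⬝ᵥ w₀)) t := by
    have h := (hasDerivAt_id t).mul_const (-(v ⬝ᵥ w₀))
    simp only [id, one_mul, mul_neg] at h
    exact h
  have hS1 : HasDerivAt (fun s => S s v) (S' t v) t := by
    rw [hS, hS']
    exact hlin.add ((hasDerivAt_line hP a v t).add ((hasDerivAt_line hE a v t).sub_const E₁))
  refine ((hS1.exp).const_mul (w v)).congr_deriv ?_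
  simp only [gibbsWeight]; ring

/-- **THE (3.29) FAMILY IS A DOMINATED DIFFERENTIABLE FAMILY** (`B14.InterpolationMeasure.DomFamily`, p27 gen 2) on the
parameter interval `(−1, 2) ⊃ [0,1]`: `F_t = w e^{S_t}` continuous and compactly supported in `v` (inside `supp χ`),
`∂_tF_t = (∂_tS_t)F_t` dominated by a constant times the indicator of `tsupport χ` (joint continuity on the compact
`[−1,2] × tsupport χ`), `∫F_t = Z_t > 0`.  This is the measure-theoretic content of the FIRST equality of (3.28).
[cite: Balaban1988Convergent, (3.28)–(3.29) pp.271–272] -/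
theorem domFamily (hχ : ContDiff ℝ 1 χ) (hχs : HasCompactSupport χ) (hχ0 : ∀ v, 0 ≤ χ v) (hχne : ∃ v, χ v ≠ 0)
    (hP : ContDiff ℝ 1 (Function.uncurry P)) (hE : ContDiff ℝ 1 (Function.uncurry E))
    {w : (ι → ℝ) → ℝ} {S S' : ℝ → (ι → ℝ) → ℝ}
    (hw : w = fun v => χ v * Real.exp (-(1/2 : ℝ) * (v ⬝ᵥ C⁻¹ *ᵥ v)))
    (hS : S = fun t v => -(t * (v ⬝ᵥ w₀)) + (P (t • a) v + (E (t • a) v - E₁)))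
    (hS' : S' = fun t v => -(v ⬝ᵥ w₀) + (fderiv ℝ (fun a' => P a' v) (t • a) a + fderiv ℝ (fun a' => E a' v) (t • a) a)) :
    DomFamily volume (gibbsWeight w S) (fun t v => S' t v * gibbsWeight w S t v) (-1) 2 := by
  have hWc := continuous_gibbsWeight₂ C w₀ a E₁ hχ hP hE hw hS
  have hS'c := continuous_S'₂ w₀ a hP hE hS'
  have hWt := continuous_gibbsWeight C w₀ a E₁ hχ hP hE hw hS
  have hF't : ∀ t, Continuous fun v => S' t v * gibbsWeight w S t v := fun t =>
    (hS'c.comp (continuous_const.prodMk continuous_id)).mul (hWt t)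
  obtain ⟨B, hB⟩ := (isCompact_Icc.prod hχs).exists_bound_of_continuousOn
    (s := Icc (-1 : ℝ) 2 ×ˢ tsupport χ) (hS'c.mul hWc).continuousOn
  refine ⟨by norm_num, by norm_num, fun t _ => (hWt t).aestronglyMeasurable, fun t _ => (hF't t).aestronglyMeasurable,
    fun t _ => (hWt t).integrable_of_hasCompactSupport (hasCompactSupport_gibbsWeight C hχs S hw t), ?_, ?_,
    fun t _ => partFn_pos C w₀ a E₁ hχ hχs hχ0 hχne hP hE hw hS t⟩
  · exact ae_of_all _ fun v t _ => hasDerivAt_gibbsWeight w₀ a E₁ hP hE w hS hS' v t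
  · refine ⟨(tsupport χ).indicator fun _ => B, ?_, ae_of_all _ fun v t ht => ?_⟩
    · rw [integrable_indicator_iff hχs.measurableSet]
      exact integrableOn_const hχs.measure_lt_top.ne
    · by_cases hv : v ∈ tsupport χ
      · rw [indicator_of_mem hv]
        have := hB (t, v) ⟨Ioo_subset_Icc_self ht, hv⟩
        simpa [Real.norm_eq_abs] using this
      · rw [indicator_of_notMem hv, gibbsWeight_eq_zero_of_notMem C S hw t hv, mul_zero, abs_zero]

/-- **(3.28), THE FIRST EQUALITY IN GIBBS FORM** (fundamental theorem of calculus in `t` with the dominated interchange):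
`log Z_1 = log Z_0 + ∫₀¹ dt ⟨∂_tS_t⟩_t`, `⟨∂_tS_t⟩_t = ⟨−⟨A, C*Δ^{(k)}CA_k⟩ + ⟨(δ/δtA_k)𝐏^{(k)}(g_k,(tA_k,A)), A_k⟩ +
⟨(δ/δtA_k)𝐄_k(U_k(….)), A_k⟩⟩_t` — the typed shape `B14.Interpolation.Eq330` INHABITED by the (3.29) family.
[cite: Balaban1988Convergent, (3.28)–(3.29) pp.271–272] -/
theorem eq328_ftc (hχ : ContDiff ℝ 1 χ) (hχs : HasCompactSupport χ) (hχ0 : ∀ v, 0 ≤ χ v) (hχne : ∃ v, χ v ≠ 0)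
    (hP : ContDiff ℝ 1 (Function.uncurry P)) (hE : ContDiff ℝ 1 (Function.uncurry E))
    {w : (ι → ℝ) → ℝ} {S S' : ℝ → (ι → ℝ) → ℝ}
    (hw : w = fun v => χ v * Real.exp (-(1/2 : ℝ) * (v ⬝ᵥ C⁻¹ *ᵥ v)))
    (hS : S = fun t v => -(t * (v ⬝ᵥ w₀)) + (P (t • a) v + (E (t • a) v - E₁)))
    (hS' : S' = fun t v => -(v ⬝ᵥ w₀) + (fderiv ℝ (fun a' => P a' v) (t • a) a + fderiv ℝ (fun a' => E a' v) (t • a) a)) :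
    Real.log (partFn volume w S 1)
      = Real.log (partFn volume w S 0) + ∫ t in (0:ℝ)..1, gibbsExpect volume w S (S' t) t :=
  (domFamily C w₀ a E₁ hχ hχs hχ0 hχne hP hE hw hS hS').eq330_family

/-- The tilted expectation `t ↦ ⟨∂_tS_t⟩_t` is integrable on `[0,1]`. [cite: Balaban1988Convergent, (3.28) p.271] -/
theorem intervalIntegrable_gibbsExpect_S' (hχ : ContDiff ℝ 1 χ) (hχs : HasCompactSupport χ) (hχ0 : ∀ v, 0 ≤ χ v)
    (hχne : ∃ v, χ v ≠ 0) (hP : ContDiff ℝ 1 (Function.uncurry P)) (hE : ContDiff ℝ 1 (Function.uncurry E))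
    {w : (ι → ℝ) → ℝ} {S S' : ℝ → (ι → ℝ) → ℝ}
    (hw : w = fun v => χ v * Real.exp (-(1/2 : ℝ) * (v ⬝ᵥ C⁻¹ *ᵥ v)))
    (hS : S = fun t v => -(t * (v ⬝ᵥ w₀)) + (P (t • a) v + (E (t • a) v - E₁)))
    (hS' : S' = fun t v => -(v ⬝ᵥ w₀) + (fderiv ℝ (fun a' => P a' v) (t • a) a + fderiv ℝ (fun a' => E a' v) (t • a) a)) :
    IntervalIntegrable (fun t => gibbsExpect volume w S (S' t) t) volume 0 1 :=
  (domFamily C w₀ a E₁ hχ hχs hχ0 hχne hP hE hw hS hS').intervalIntegrable_logDeriv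

end Family

end Literature.MathematicalPhysics.QuantumFieldTheory.Balaban1983to89.B14.Eq329Family

end
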